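import Summits.ResolutionOfSingularities.ResolutionOfSingularities.Theorems.PAlterationPalterationThesisStubQuotientInduction
import HarnessLib

/-!
# Crux `PalterationThesis` (stmt-ResolutionOfSingularities-0552), line `Sketch` rev. c2:
# the residue `R1D` is card 2's `R1Perfect` verbatim (untwisted: coatoms of `K(W)^{1/p}`)

Route `ResolutionOfSingularities/pAlteration`; helper file (`--supports stmt-0552`). The crux idea
card `Ideas/multiplicative-residue-tame-destack.md` states its residue as

  `R1Perfect`: for `W` regular integral separated of finite type over a perfect field `k` of
  characteristic `p` and fields `K(W) → L → M` with `M` playing `K(W)^{1/p}` — every `x ∈ M`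
  has `x^p ∈ K(W)` and every `y ∈ K(W)` is a `p`-th power `x^p`, `x ∈ M` — and `[M : L] = p`,
  the normalisation `W^L` has a resolution

(here `R1U_K`, "U" for untwisted; we add the harmless hypothesis that `L/K(W)` is finite, which
is automatic by F-finiteness). The line's registered residue `R1D_K` replaces the pair `(L, M)`
by a ring map `β : L → K(W)` with `β ∘ (K(W) → L) = Frobenius` and `[K(W) : β(L)] = p`
(Frobenius-twisted coordinates: `β = (x ↦ x^p)` read in `K(W) ≅ K(W)^{1/p}`). This file proves
the two forms EQUIVALENT over any field `K` of characteristic `p` for which the Frobenius power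
endomorphism of `W` is dominant (no perfectness is needed for the dictionary itself):

* `r1U_of_r1D` — from `(L, M)` build `β := ψ ∘ (L → M)` with `ψ : M → K(W)`, `ψ x := ` the
  `y` with `x^p = y`; `ψ` is a ring isomorphism carrying `L` onto `β(L)`, so the indices agree;
* `r1D_of_r1U` — from `(E, β)` take `M := (K(W), Frob)` (`FunctionFieldOver F` for the
  Frobenius power endomorphism `F` of `W`) with `E → M`, `e ↦ β e`;
* `r1D_iff_r1U`.
-/

set_option linter.dupNamespace false

noncomputable section

open CategoryTheory AlgebraicGeometry TopologicalSpace
open Literature.AlgebraicGeometry.Resolution Literature.AlgebraicGeometry.Motives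

namespace Summit.ResolutionOfSingularities.ResolutionOfSingularities.Theorems.PalterationThesis.PerfectQuotient

/-! ## The `p`-th power map `M → K` of an exponent-one extension all of whose base elements are `p`-th powers -/

/-- **The `p`-th power isomorphism `M ≅ K`.** Let `M/F` be a field extension of characteristic
`p` such that every `x ∈ M` has `x^p ∈ F` and every `y ∈ F` is `x^p` for some `x ∈ M`. Then
`x ↦ (the y with x^p = y)` is a ring isomorphism `ψ : M ≃+* F` with `ψ (algebraMap y) = y^p` and
`algebraMap (ψ x) = x^p`. [folklore] -/
theorem exists_ringEquiv_pow_eq {F M : Type*} [Field F] [Field M] [Algebra F M] (p : ℕ)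
    [Fact p.Prime] [CharP M p]
    (h1 : ∀ x : M, x ^ p ∈ (algebraMap F M).range)
    (h2 : ∀ y : F, ∃ x : M, x ^ p = algebraMap F M y) :
    ∃ ψ : M ≃+* F, (∀ x : M, algebraMap F M (ψ x) = x ^ p) ∧
      ∀ y : F, ψ (algebraMap F M y) = y ^ p := by
  haveI : CharP F p := (algebraMap F M).charP (algebraMap F M).injective p
  choose g hg using h1
  have hinj : Function.Injective (algebraMap F M) := (algebraMap F M).injective
  -- `g` is a ring homomorphism
  let ψ₀ : M →+* F :=
    { toFun := g
      map_one' := hinj (by rw [hg, one_pow, map_one])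
      map_mul' := fun x y => hinj (by rw [hg, map_mul, hg, hg, mul_pow])
      map_zero' := hinj (by rw [hg, zero_pow (Fact.out : p.Prime).ne_zero, map_zero])
      map_add' := fun x y => hinj (by rw [hg, map_add, hg, hg, add_pow_char]) }
  have hψ₀ : ∀ x, algebraMap F M (ψ₀ x) = x ^ p := fun x => hg x
  have hsurj : Function.Surjective ψ₀ := by
    intro y
    obtain ⟨x, hx⟩ := h2 y
    exact ⟨x, hinj (by rw [hψ₀, hx])⟩
  refine ⟨RingEquiv.ofBijective ψ₀ ⟨ψ₀.injective, hsurj⟩, fun x => hψ₀ x, fun y => ?_⟩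
  apply hinj
  change algebraMap F M (ψ₀ (algebraMap F M y)) = _
  rw [hψ₀, map_pow]

/-! ## `R1D ⟹ R1U` -/

/-- **`R1D_K` implies card 2's `R1Perfect` (`R1U_K`).** [folklore] -/
theorem r1U_of_r1D (p : ℕ) (hp : p.Prime) (K : Type) [Field K] [CharP K p]
    (hR1D : ∀ (B : Scheme.{0}) [IsIntegral B] (f : B ⟶ Spec (.of K)),
        IsSeparated f → LocallyOfFiniteType f → QuasiCompact f → Scheme.IsRegular B →
        ∀ (E : Type) [Field E] [Algebra B.functionField E] [FiniteDimensional B.functionField E]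
          (β : E →+* B.functionField),
          (∀ b : B.functionField, β (algebraMap B.functionField E b) = b ^ p) →
          Module.finrank β.fieldRange B.functionField = p →
          Scheme.HasResolution (normalizationIn B E)) :
    ∀ (W : Scheme.{0}) [IsIntegral W] (f : W ⟶ Spec (.of K)),
      IsSeparated f → LocallyOfFiniteType f → QuasiCompact f → Scheme.IsRegular W →
      ∀ (L M : Type) [Field L] [Field M] [Algebra W.functionField L] [Algebra W.functionField M]
        [Algebra L M] [IsScalarTower W.functionField L M] [FiniteDimensional W.functionField L],
        (∀ x : M, x ^ p ∈ (algebraMap W.functionField M).range) →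
        (∀ y : W.functionField, ∃ x : M, x ^ p = algebraMap W.functionField M y) →
        Module.finrank L M = p → Scheme.HasResolution (normalizationIn W L) := by
  intro W _ f hs hl hq hW L M _ _ _ _ _ _ _ h1 h2 hdeg
  haveI : Fact p.Prime := ⟨hp⟩
  haveI : CharP W.functionField p := Picover.TowerTransport.charP_functionField W f
  haveI : CharP M p := charP_of_injective_algebraMap (algebraMap W.functionField M).injective p
  obtain ⟨ψ, hψ, hψ'⟩ := exists_ringEquiv_pow_eq p h1 h2
  -- `β := ψ ∘ (L → M)`
  let β : L →+* W.functionField := ψ.toRingHom.comp (algebraMap L M)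
  have hβ : ∀ b : W.functionField, β (algebraMap W.functionField L b) = b ^ p := by
    intro b
    change ψ (algebraMap L M (algebraMap W.functionField L b)) = b ^ p
    rw [← IsScalarTower.algebraMap_apply, hψ']
  refine hR1D W f hs hl hq hW L β hβ ?_
  -- `[K(W) : β(L)] = [M : L]`, transporting along `ψ`
  rw [← hdeg, finrank_fieldRange_eq]
  letI : Algebra L W.functionField := β.toAlgebra
  symm
  refine Algebra.finrank_eq_of_equiv_equiv (RingEquiv.refl L) ψ ?_
  ext x
  rfl

/-! ## `R1U ⟹ R1D` -/

/-- **Card 2's `R1Perfect` (`R1U_K`) implies `R1D_K`**: for `(E, β)` take `M := (K(W), Frob)`,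
the function field of `W` as an algebra over itself through the Frobenius power endomorphism.
[folklore] -/
theorem r1D_of_r1U (p : ℕ) (hp : p.Prime) (K : Type) [Field K] [CharP K p]
    (hR1U : ∀ (W : Scheme.{0}) [IsIntegral W] (f : W ⟶ Spec (.of K)),
      IsSeparated f → LocallyOfFiniteType f → QuasiCompact f → Scheme.IsRegular W →
      ∀ (L M : Type) [Field L] [Field M] [Algebra W.functionField L] [Algebra W.functionField M]
        [Algebra L M] [IsScalarTower W.functionField L M] [FiniteDimensional W.functionField L],
        (∀ x : M, x ^ p ∈ (algebraMap W.functionField M).range) →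
        (∀ y : W.functionField, ∃ x : M, x ^ p = algebraMap W.functionField M y) →
        Module.finrank L M = p → Scheme.HasResolution (normalizationIn W L)) :
    ∀ (B : Scheme.{0}) [IsIntegral B] (f : B ⟶ Spec (.of K)),
        IsSeparated f → LocallyOfFiniteType f → QuasiCompact f → Scheme.IsRegular B →
        ∀ (E : Type) [Field E] [Algebra B.functionField E] [FiniteDimensional B.functionField E]
          (β : E →+* B.functionField),
          (∀ b : B.functionField, β (algebraMap B.functionField E b) = b ^ p) →
          Module.finrank β.fieldRange B.functionField = p →
          Scheme.HasResolution (normalizationIn B E) := by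
  intro B _ f hs hl hq hB E _ _ _ β hβ hdeg
  haveI : Fact p.Prime := ⟨hp⟩
  -- the Frobenius power endomorphism `F` of `B` (dominant: identity on points)
  have hpB : (p : Γ(B, ⊤)) = 0 := natCast_appTop_eq_zero p f
  have hadd := add_pow_sections p hpB 1
  set F := powEndo B (p ^ 1) (pow_ne_zero 1 hp.ne_zero) hadd with hFdef
  haveI : Surjective F := ⟨fun x => ⟨x, rfl⟩⟩
  have hF : ∀ y : B.functionField, RatFn.functionFieldMap F y = y ^ p ^ 1 :=
    functionFieldMap_powEndo B (p ^ 1) _ hadd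
  have halg : ∀ b : B.functionField,
      algebraMap B.functionField (FunctionFieldOver F) b = FunctionFieldOver.of F (b ^ p) := by
    intro b
    rw [FunctionFieldOver.algebraMap_apply, hF, pow_one]
  -- `M := (K(B), F^♯)` as an `E`-algebra through `β`
  letI algEM : Algebra E (FunctionFieldOver F) := ((FunctionFieldOver.of F).toRingHom.comp β).toAlgebra
  haveI : IsScalarTower B.functionField E (FunctionFieldOver F) := by
    refine IsScalarTower.of_algebraMap_eq fun b => ?_
    change _ = FunctionFieldOver.of F (β (algebraMap B.functionField E b))
    rw [hβ, halg]
  have h1 : ∀ x : FunctionFieldOver F,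
      x ^ p ∈ (algebraMap B.functionField (FunctionFieldOver F)).range := fun x =>
    ⟨(FunctionFieldOver.of F).symm x, by rw [halg, map_pow, RingEquiv.apply_symm_apply]⟩
  have h2 : ∀ y : B.functionField, ∃ x : FunctionFieldOver F,
      x ^ p = algebraMap B.functionField (FunctionFieldOver F) y := fun y =>
    ⟨FunctionFieldOver.of F y, by rw [halg, map_pow]⟩
  have hdegM : Module.finrank E (FunctionFieldOver F) = p := by
    rw [← hdeg, finrank_fieldRange_eq]
    letI : Algebra E B.functionField := β.toAlgebra
    symm
    refine Algebra.finrank_eq_of_equiv_equiv (RingEquiv.refl E) (FunctionFieldOver.of F) ?_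
    ext x
    rfl
  exact hR1U B f hs hl hq hB E (FunctionFieldOver F) h1 h2 hdegM

/-- **`R1D_K ⟺ R1U_K`**: the line's registered residue is card 2's `R1Perfect` verbatim (up to
the automatic finiteness of `L/K(W)`). [folklore] -/
theorem r1D_iff_r1U (p : ℕ) (hp : p.Prime) (K : Type) [Field K] [CharP K p] :
    (∀ (B : Scheme.{0}) [IsIntegral B] (f : B ⟶ Spec (.of K)),
        IsSeparated f → LocallyOfFiniteType f → QuasiCompact f → Scheme.IsRegular B →
        ∀ (E : Type) [Field E] [Algebra B.functionField E] [FiniteDimensional B.functionField E]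
          (β : E →+* B.functionField),
          (∀ b : B.functionField, β (algebraMap B.functionField E b) = b ^ p) →
          Module.finrank β.fieldRange B.functionField = p →
          Scheme.HasResolution (normalizationIn B E)) ↔
    ∀ (W : Scheme.{0}) [IsIntegral W] (f : W ⟶ Spec (.of K)),
      IsSeparated f → LocallyOfFiniteType f → QuasiCompact f → Scheme.IsRegular W →
      ∀ (L M : Type) [Field L] [Field M] [Algebra W.functionField L] [Algebra W.functionField M]
        [Algebra L M] [IsScalarTower W.functionField L M] [FiniteDimensional W.functionField L],
        (∀ x : M, x ^ p ∈ (algebraMap W.functionField M).range) →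
        (∀ y : W.functionField, ∃ x : M, x ^ p = algebraMap W.functionField M y) →
        Module.finrank L M = p → Scheme.HasResolution (normalizationIn W L) :=
  ⟨r1U_of_r1D p hp K, r1D_of_r1U p hp K⟩

end Summit.ResolutionOfSingularities.ResolutionOfSingularities.Theorems.PalterationThesis.PerfectQuotient

end
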